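import Summits.QuantumAdvantage.QuantumAdvantage.Theorems.CharDialPlaneDivAscentF1
import HarnessLib

/-!
# PlaneDivAscent — PART F2: the three-block set, its plane-divisibility, periodlessness, ★ `not_law_three`
(continuation of F1; see F1's module docstring.)
-/

set_option autoImplicit false

namespace Summit.QuantumAdvantage.AdviceFreeQNC0.PlaneDiv

open Finset Module

section ThreeBlock

variable {p : ℕ} [Fact p.Prime]

/-! ### The three-block set -/

/-- `ι c = 0` if `c = 0`, else `1`. -/
def iota (c : ZMod p) : ZMod p := if c = 0 then 0 else 1

/-- `ι 0 = 0`. -/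
@[simp] theorem iota_zero : iota (0 : ZMod p) = 0 := by simp [iota]

/-- `ι c = 1` for `c ≠ 0`. -/
theorem iota_of_ne {c : ZMod p} (h : c ≠ 0) : iota c = 1 := by simp [iota, h]

/-- `ι` takes only the values `0, 1`. -/
theorem iota_cases (c : ZMod p) : iota c = 0 ∨ iota c = 1 := by
  unfold iota; split_ifs <;> simp

/-- one can always move the `ι`-value of a translate away from a prescribed target -/
theorem exists_iota_add_ne (t r : ZMod p) : ∃ c : ZMod p, iota (c + r) ≠ t := by
  by_cases ht : t = 0
  · refine ⟨1 - r, ?_⟩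
    rw [show (1 : ZMod p) - r + r = 1 by ring, iota_of_ne one_ne_zero, ht]; exact one_ne_zero
  · refine ⟨-r, ?_⟩
    rw [show -r + r = (0 : ZMod p) by ring, iota_zero]; exact Ne.symm ht

/-- The graph `A = {(ι c, c) : c ∈ 𝔽_p}`; `#A = p`. -/
def baseA (p : ℕ) [Fact p.Prime] : Finset (ZMod p × ZMod p) :=
  Finset.univ.image fun c => (iota c, c)

/-- Membership in the base graph. -/
theorem mem_baseA {q : ZMod p × ZMod p} : q ∈ baseA p ↔ q.1 = iota q.2 := by
  constructor
  · intro h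
    rcases Finset.mem_image.mp h with ⟨c, -, rfl⟩
    rfl
  · intro h
    exact Finset.mem_image.mpr ⟨q.2, Finset.mem_univ _, by ext <;> simp [h]⟩

/-- The base graph has exactly `p` points. -/
theorem card_baseA : (baseA p).card = p := by
  unfold baseA
  rw [Finset.card_image_of_injective _ (fun c c' h => by simpa using congrArg Prod.snd h)]
  simp [ZMod.card]

open Classical in
/-- THE THREE-BLOCK SET `S ⊆ 𝔽_p⁴` (`|S| = 3p³`): block 0 on slabs `y₃ ∈ {0,1}` keyed by `y₂`, block 1 on slabs
`{2,3}` keyed by `y₀`, block 2 on slabs `{4,5}` keyed by `y₁`. -/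
noncomputable def S3 (p : ℕ) [Fact p.Prime] : Finset (Fin 4 → ZMod p) :=
  Finset.univ.filter fun y => y 3 = iota (y 2) ∨ y 3 - 2 = iota (y 0) ∨ y 3 - 4 = iota (y 1)

/-- Membership in the three-block set. -/
theorem mem_S3 {y : Fin 4 → ZMod p} :
    y ∈ S3 p ↔ (y 3 = iota (y 2) ∨ y 3 - 2 = iota (y 0) ∨ y 3 - 4 = iota (y 1)) := by
  classical
  unfold S3
  rw [Finset.mem_filter]
  simp

/-- the three blocks are pairwise disjoint (needs `1,2,3,4,5 ≠ 0`, i.e. `p ≥ 7`) -/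
theorem sub_two_ne {u v : ZMod p} (hu : u = 0 ∨ u = 1) (hv : v = 0 ∨ v = 1)
    (h2 : (2 : ZMod p) ≠ 0) (h3 : (3 : ZMod p) ≠ 0) : u - 2 ≠ v := by
  have h1 : (1 : ZMod p) ≠ 0 := one_ne_zero
  rcases hu with rfl | rfl <;> rcases hv with rfl | rfl <;> intro h
  · exact h2 (by linear_combination -h)
  · exact h3 (by linear_combination -h)
  · exact h1 (by linear_combination -h)
  · exact h2 (by linear_combination -h)

/-- companion of `sub_two_ne` for the label gap `4` -/
theorem sub_four_ne {u v : ZMod p} (hu : u = 0 ∨ u = 1) (hv : v = 0 ∨ v = 1)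
    (h3 : (3 : ZMod p) ≠ 0) (h4 : (4 : ZMod p) ≠ 0) (h5 : (5 : ZMod p) ≠ 0) : u - 4 ≠ v := by
  rcases hu with rfl | rfl <;> rcases hv with rfl | rfl <;> intro h
  · exact h4 (by linear_combination -h)
  · exact h5 (by linear_combination -h)
  · exact h3 (by linear_combination -h)
  · exact h4 (by linear_combination -h)

/-- indicator of an exclusive triple disjunction = sum of the indicators -/
theorem ite_or_or_eq_add {A B C : Prop} [Decidable A] [Decidable B] [Decidable C]
    (hAB : ¬(A ∧ B)) (hAC : ¬(A ∧ C)) (hBC : ¬(B ∧ C)) :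
    (if A ∨ B ∨ C then 1 else 0 : ℕ) =
      (if A then 1 else 0) + (if B then 1 else 0) + (if C then 1 else 0) := by
  by_cases a : A <;> by_cases b : B <;> by_cases c : C <;> simp_all

/-- PLANE COUNT = sum of the three block counts, each an affine `2 × 2` preimage of the base `A`. -/
theorem planeCount_S3 (hp : 7 ≤ p) (x a b : Fin 4 → ZMod p) :
    planeCount (S3 p) x a b =
      (Finset.univ.filter fun st : ZMod p × ZMod p =>
          (x 3 + st.1 * a 3 + st.2 * b 3, x 2 + st.1 * a 2 + st.2 * b 2) ∈ baseA p).card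
      + (Finset.univ.filter fun st : ZMod p × ZMod p =>
          (x 3 - 2 + st.1 * a 3 + st.2 * b 3, x 0 + st.1 * a 0 + st.2 * b 0) ∈ baseA p).card
      + (Finset.univ.filter fun st : ZMod p × ZMod p =>
          (x 3 - 4 + st.1 * a 3 + st.2 * b 3, x 1 + st.1 * a 1 + st.2 * b 1) ∈ baseA p).card := by
  classical
  have h2 := two_ne_zero' hp
  have h3 := three_ne_zero' hp
  have h4 := four_ne_zero' hp
  have h5 := five_ne_zero' hp
  unfold planeCount
  rw [Finset.card_filter, Finset.card_filter, Finset.card_filter, Finset.card_filter,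
    ← Finset.sum_add_distrib, ← Finset.sum_add_distrib]
  refine Finset.sum_congr rfl fun st _ => ?_
  have e3 : (x + st.1 • a + st.2 • b) 3 = x 3 + st.1 * a 3 + st.2 * b 3 := by simp
  have e2 : (x + st.1 • a + st.2 • b) 2 = x 2 + st.1 * a 2 + st.2 * b 2 := by simp
  have e1 : (x + st.1 • a + st.2 • b) 1 = x 1 + st.1 * a 1 + st.2 * b 1 := by simp
  have e0 : (x + st.1 • a + st.2 • b) 0 = x 0 + st.1 * a 0 + st.2 * b 0 := by simp
  have key : (x + st.1 • a + st.2 • b ∈ S3 p) ↔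
      ((x 3 + st.1 * a 3 + st.2 * b 3, x 2 + st.1 * a 2 + st.2 * b 2) ∈ baseA p ∨
       (x 3 - 2 + st.1 * a 3 + st.2 * b 3, x 0 + st.1 * a 0 + st.2 * b 0) ∈ baseA p ∨
       (x 3 - 4 + st.1 * a 3 + st.2 * b 3, x 1 + st.1 * a 1 + st.2 * b 1) ∈ baseA p) := by
    rw [mem_S3, mem_baseA, mem_baseA, mem_baseA, e3, e2, e1, e0]
    simp only
    rw [show x 3 + st.1 * a 3 + st.2 * b 3 - 2 = x 3 - 2 + st.1 * a 3 + st.2 * b 3 by ring,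
      show x 3 + st.1 * a 3 + st.2 * b 3 - 4 = x 3 - 4 + st.1 * a 3 + st.2 * b 3 by ring]
  rw [if_congr key rfl rfl]
  apply ite_or_or_eq_add
  · rw [mem_baseA, mem_baseA]
    rintro ⟨hA, hB⟩
    simp only at hA hB
    have hh : iota (x 2 + st.1 * a 2 + st.2 * b 2) - 2 = iota (x 0 + st.1 * a 0 + st.2 * b 0) := by
      rw [← hA, ← hB]; ring
    exact sub_two_ne (iota_cases _) (iota_cases _) h2 h3 hh
  · rw [mem_baseA, mem_baseA]
    rintro ⟨hA, hC⟩
    simp only at hA hC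
    have hh : iota (x 2 + st.1 * a 2 + st.2 * b 2) - 4 = iota (x 1 + st.1 * a 1 + st.2 * b 1) := by
      rw [← hA, ← hC]; ring
    exact sub_four_ne (iota_cases _) (iota_cases _) h3 h4 h5 hh
  · rw [mem_baseA, mem_baseA]
    rintro ⟨hB, hC⟩
    simp only at hB hC
    have hh : iota (x 0 + st.1 * a 0 + st.2 * b 0) - 2 = iota (x 1 + st.1 * a 1 + st.2 * b 1) := by
      rw [← hB, ← hC]; ring
    exact sub_two_ne (iota_cases _) (iota_cases _) h2 h3 hh

/-- THE THREE-BLOCK SET IS PLANE-DIVISIBLE (`p ≥ 7`). -/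
theorem planeCount_S3_dvd (hp : 7 ≤ p) (x a b : Fin 4 → ZMod p) : p ∣ planeCount (S3 p) x a b := by
  have hA : p ∣ (baseA p).card := by rw [card_baseA]
  rw [planeCount_S3 hp]
  exact dvd_add (dvd_add (dvd_card_affine_preimage _ hA _ _ _ _ _ _)
    (dvd_card_affine_preimage _ hA _ _ _ _ _ _)) (dvd_card_affine_preimage _ hA _ _ _ _ _ _)

/-- THE THREE-BLOCK SET HAS NO NONZERO PERIOD (`p ≥ 7`). -/
theorem not_period_S3 (hp : 7 ≤ p) (d : Fin 4 → ZMod p) (hd : d ≠ 0) :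
    ¬ ∀ x, x ∈ S3 p ↔ x + d ∈ S3 p := by
  intro hper
  have h1 : (1 : ZMod p) ≠ 0 := one_ne_zero
  have h2 := two_ne_zero' hp
  have h3 := three_ne_zero' hp
  have h4 := four_ne_zero' hp
  have h5 := five_ne_zero' hp
  have viol : ∀ x : Fin 4 → ZMod p, x ∈ S3 p → x + d ∉ S3 p → False :=
    fun x hx hxd => hxd ((hper x).mp hx)
  by_cases hδ : d 3 = 0
  · by_cases hd2 : d 2 = 0
    · by_cases hd0 : d 0 = 0
      · -- then `d 1 ≠ 0`
        have hd1 : d 1 ≠ 0 := by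
          intro h; apply hd; funext i
          fin_cases i
          · exact hd0
          · exact h
          · exact hd2
          · exact hδ
        refine viol ![0, 0, 0, 4] ?_ ?_
        · rw [mem_S3]; right; right; simp
        · rw [mem_S3]
          have e3 : (![(0 : ZMod p), 0, 0, 4] + d) 3 = 4 := by simp [hδ]
          have e2 : (![(0 : ZMod p), 0, 0, 4] + d) 2 = 0 := by simp [hd2]
          have e0 : (![(0 : ZMod p), 0, 0, 4] + d) 0 = 0 := by simp [hd0]
          have e1 : (![(0 : ZMod p), 0, 0, 4] + d) 1 = d 1 := by simp
          rintro (h | h | h)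
          · rw [e3, e2, iota_zero] at h; exact h4 h
          · rw [e3, e0, iota_zero] at h; exact h2 (by linear_combination h)
          · rw [e3, e1, iota_of_ne hd1] at h; exact h1 (by linear_combination -h)
      · refine viol ![0, 0, 0, 2] ?_ ?_
        · rw [mem_S3]; right; left; simp
        · rw [mem_S3]
          have e3 : (![(0 : ZMod p), 0, 0, 2] + d) 3 = 2 := by simp [hδ]
          have e2 : (![(0 : ZMod p), 0, 0, 2] + d) 2 = 0 := by simp [hd2]
          have e0 : (![(0 : ZMod p), 0, 0, 2] + d) 0 = d 0 := by simp
          have e1 : (![(0 : ZMod p), 0, 0, 2] + d) 1 = d 1 := by simp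
          rintro (h | h | h)
          · rw [e3, e2, iota_zero] at h; exact h2 h
          · rw [e3, e0, iota_of_ne hd0] at h; exact h1 (by linear_combination -h)
          · rw [e3, e1] at h
            rcases iota_cases (d 1) with e | e <;> rw [e] at h
            · exact h2 (by linear_combination -h)
            · exact h3 (by linear_combination -h)
    · refine viol 0 ?_ ?_
      · rw [mem_S3]; left; simp
      · rw [zero_add, mem_S3]
        rintro (h | h | h)
        · rw [hδ, iota_of_ne hd2] at h; exact h1 h.symm
        · rw [hδ] at h
          rcases iota_cases (d 0) with e | e <;> rw [e] at h
          · exact h2 (by linear_combination -h)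
          · exact h3 (by linear_combination -h)
        · rw [hδ] at h
          rcases iota_cases (d 1) with e | e <;> rw [e] at h
          · exact h4 (by linear_combination -h)
          · exact h5 (by linear_combination -h)
  · by_cases hB2 : d 3 = 1 ∧ d 2 ≠ 0
    · obtain ⟨hδ1, hd2⟩ := hB2
      refine viol ![1 - d 0, 0, -d 2, 1] ?_ ?_
      · rw [mem_S3]; left
        have : -d 2 ≠ 0 := neg_ne_zero.mpr hd2
        simp [iota_of_ne this]
      · rw [mem_S3]
        have e3 : (![1 - d 0, 0, -d 2, 1] + d) 3 = 2 := by simp [hδ1]; norm_num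
        have e2 : (![1 - d 0, 0, -d 2, 1] + d) 2 = 0 := by simp
        have e0 : (![1 - d 0, 0, -d 2, 1] + d) 0 = 1 := by simp
        have e1 : (![1 - d 0, 0, -d 2, 1] + d) 1 = d 1 := by simp
        rintro (h | h | h)
        · rw [e3, e2, iota_zero] at h; exact h2 h
        · rw [e3, e0, iota_of_ne h1] at h; exact h1 (by linear_combination -h)
        · rw [e3, e1] at h
          rcases iota_cases (d 1) with e | e <;> rw [e] at h
          · exact h2 (by linear_combination -h)
          · exact h3 (by linear_combination -h)
    · obtain ⟨x0, hx0⟩ := exists_iota_add_ne (d 3 - 2) (d 0)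
      obtain ⟨x1, hx1⟩ := exists_iota_add_ne (d 3 - 4) (d 1)
      refine viol ![x0, x1, 0, 0] ?_ ?_
      · rw [mem_S3]; left; simp
      · rw [mem_S3]
        have e3 : (![x0, x1, 0, 0] + d) 3 = d 3 := by simp
        have e2 : (![x0, x1, 0, 0] + d) 2 = d 2 := by simp
        have e0 : (![x0, x1, 0, 0] + d) 0 = x0 + d 0 := by simp
        have e1 : (![x0, x1, 0, 0] + d) 1 = x1 + d 1 := by simp
        rintro (h | h | h)
        · rw [e3, e2] at h
          by_cases hd2 : d 2 = 0
          · rw [hd2, iota_zero] at h; exact hδ h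
          · rw [iota_of_ne hd2] at h; exact hB2 ⟨h, hd2⟩
        · rw [e3, e0] at h; exact hx0 h.symm
        · rw [e3, e1] at h; exact hx1 h.symm

/-- ★ MAIN (model-space form): for every prime `p ≥ 7` there is a subset of `𝔽_p⁴` all of whose parametrised
plane counts are divisible by `p` and which has NO nonzero period (the three-block set). -/
theorem exists_planeDiv_periodless_four (hp : 7 ≤ p) :
    ∃ S : Finset (Fin 4 → ZMod p), (∀ x a b : Fin 4 → ZMod p, p ∣ planeCount S x a b) ∧
      ∀ d : Fin 4 → ZMod p, d ≠ 0 → ¬ ∀ x, x ∈ S ↔ x + d ∈ S :=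
  ⟨S3 p, planeCount_S3_dvd hp, not_period_S3 hp⟩

/-- ★ REFUTATION OF THE UNIFORM CODIMENSION LAW `K = 3`: for every prime `p ≥ 7` it is FALSE that every
plane-divisible set in every subspace `W ≤ 𝔽_pⁿ` is a cylinder over `≤ 3` dimensions (via the dimension
elimination `law_iff_top 3` of Part D and the three-block set).  In particular the field core `K_field(p)` of the
second structure law is `≥ 4` for all `p ≥ 7`; only per-prime finiteness can survive. -/
theorem not_law_three (hp : 7 ≤ p) :
    ¬ ∀ (n : ℕ) (W : Submodule (ZMod p) (Fin n → ZMod p)) (S : Finset (Fin n → ZMod p)),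
        (∀ x ∈ S, x ∈ W) → (∀ x ∈ W, ∀ a ∈ W, ∀ b ∈ W, p ∣ planeCount S x a b) →
        finrank (ZMod p) W ≤ finrank (ZMod p) (perIn W S) + 3 := by
  intro h
  obtain ⟨d, hd, hd0⟩ := (law_iff_top 3).mp h (S3 p) (planeCount_S3_dvd hp)
  exact not_period_S3 hp d hd0 (mem_perIn.mp hd).2

end ThreeBlock

end Summit.QuantumAdvantage.AdviceFreeQNC0.PlaneDiv
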